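import Literature.MathematicalPhysics.QuantumFieldTheory.Balaban1983to89.Beta.TransportVertices
import Literature.MathematicalPhysics.QuantumFieldTheory.Balaban1983to89.Beta.BackgroundVertices

/-!
# `Balaban1983to89.Beta.AdjointTransportJets` — the background jets of ADJOINT TRANSPORT ALONG A CONTOUR
# (the convention-free algebraic core of the linearised covariant averaging operators), v1.0.2

HONEST FRAMING (page 1, mandatory).  This leaf belongs to the β sub-cell of the Bałaban audit, whose END STATEMENT is:
discharging the one-loop hypothesis `FlowStep.BetaPertH` (read at END-STATEMENT grade, RULING (R6)) makes Bałaban's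
ultraviolet stability theorem for 4-d lattice Yang–Mills ([Balaban1989LargeFieldII], Thm. 1 p. 355 (B16))
UNCONDITIONAL inside this package — a real constructive-QFT result; it is NOT the continuum limit and NOT the Clay
problem.  Gloss 2: EVERYTHING below is kernel-proved [folklore] matrix/normed-algebra calculus; NOTHING is cited as a
fact.  The equations of [Balaban1985BackgroundPropagators] (= B9, CMP 99 (1985) 389–434) and
[Balaban1985Averaging] (= B7, CMP 98 (1985) 17–51) quoted here are quoted only to say WHICH object is
being typed; the manuscripts under audit are not citable for their disputed steps and no programme-internal claim
enters.

ABSOLUTE RULE (cell charter, verbatim; header line added v1.0.2 per beta-ref advisory A-R371, docstring-only): «No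
internally-minted statement may enter as a cited fact. Every hypothesis is either kernel-proved in this package or a
verbatim quotation of a PUBLISHED theorem with page reference. The manuscript(s) under audit are NOT citable for their
own disputed steps — they are the thing under adjudication; programme-internal (2001/route/tribunal) claims are never
citable.»  Accordingly NO declaration below is a `def … : Prop` carrying a citation and no hypothesis of any theorem is
a printed statement: every declaration is [folklore]; the quotations are object LOCATORS only.

WHAT IS BEING TYPED, AND WHY (the (V-H) brick of RULING (R18-3); `BETA/AN1.md` §25.6 «VH-STENCIL»; an2's request,
journal l.49649 (2)(b)).  Bałaban's covariant block averagings act on the fine field by ADJOINT TRANSPORT ALONG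
CONTOURS.  Verbatim (renders of B9 read as page images, PDF p.5 = p.393, p.6 = p.394):
* B9 p.393 (3.18)–(3.19), the scalar-field averaging: «(Q′(V)λ)(y) = Σ_{x∈B(y)} L^{−d} R(V(Γ_{y,x})) λ(x),
  (Q′_j(U)λ)(y) = (Q′(Ū^{j−1})·…·Q′(Ū)Q′(U)λ)(y) = Σ_{x∈B^j(y)} L^{−jd} R(U(Γ^{(j)}_{y,x})) λ(x), y ∈ T^{(j)}_{L^jη}»,
  «The contours Γ^{(j)}_{y,x}, x ∈ B^j(y), and the contour variables U(Γ^{(j)}_{y,x}) were defined by (52), (53) in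
  [5]» (`R` the adjoint representation — B7 p.27 (56) «R(X)Y = XYX⁻¹», (57) «R(X)R(Y) = R(XY)»; [5] = B7, cited in B9
  as the preprint HUTMP B147: in the PUBLISHED CMP 98 the contour definitions are the display after (44) on p.24
  (`Γ_{y,x}`), p.19 (`Γ_{c,x}`) and p.29 before (77) (the composite contours), whereas (52)–(53) of CMP 98 p.26 are
  regularity bounds — locator correction owed to the XREAD of v1, beta-lit3-g18, journal 2026-08-19T10:20:15Z, D1/D3);
  p.394 l.1–2: «Q′_j(U) are linear parts of the averaging operations R̄u^j … (78)–(80) in [5]»;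
* B9 p.393 (3.14)–(3.15), the vector-field averaging: «(1/(L^jη)) Q_j(U, ηA) = Q_j(U)A + (1/(L^jη)) C_j(U, L^jηA),
  where Q_j(U)A is a linear part of the function (3.13) and C_j(U,A) is an analytic function of A whose expansion
  begins with second order terms», «Q_j(U) = Q(Ū^{j−1})·…·Q(Ū)Q(U) (3.15), where Q(V) is given by the explicit
  formula (124) in [5]».
So at the trivial background `U = 1` perturbed to `V = e^{tB}`, every `B`-jet of the SCALAR averagings (3.19), and of
the MAIN TERM of the vector one-step averaging (B7 p.36 (125) «(Q₀A)_c = Σ_{x∈B(c_−)} L^{−(d+1)}(R_{0,c_−}A)([x,x′])»),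
is a weighted sum of jets of the conjugation paths `t ↦ Hol_Γ(t) · λ · Hol_Γ(t)⁻¹`, `Hol_Γ(t) = Π_{b∈Γ} e^{t B_b}` —
whatever the contour geometry.  (SCOPE CORRECTION v1.0.1, XREAD D2: the FULL vector formula B7 p.36 (124), which (3.15)
composes, dresses these transports with the BCH operator coefficients `g(−i ad_Y)g^{−1}(∓i ad_{Y_x})`, `e^{±i ad_Y}`
(`g(z) = (1 − e^{−z})/z`, B7 (32)–(34); `Y_x = (1/i) log V₀(Γ_{c,x} ∪ (−c))`, B7 (114)); they EQUAL 1 at `V₀ = 1` but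
have NONZERO `B`-jets there (`Ẏ_x(0)` = the circulation of `B` around the closed contour, `g′(0) = −½`), so the vector
(V-H) stencil has additional commutator terms — in the span of this module's alphabet, with `g`'s Taylor
coefficients; their first-jet calculus is the sequel `Beta.AveragingCorrectionJets` (p186574).)  This module supplies
exactly those conjugation jets, ON TOP OF an2's `Beta.TransportVertices` (§3 there:
`holPath`, `D₁`, `D₂`, `hasDerivAt_holPath`, `hasDerivAt_D₁`, `D₁_zero`, `D₂_zero`, `commSum`, `size`,
`norm_sum_le_size`, `norm_commSum_le` — used BY NAME, nothing restated) and b12/an2's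
`Beta.BackgroundVertices.mem_eball_expSeries_radius` (infinite radius of `exp` over `𝕜 = ℝ, ℂ`).

CONTENT (all [folklore]; `𝕜` is `RCLike`, `𝔸` a complete normed `𝕜`-algebra — Bałaban's letters are `𝔸 = Mat_N(ℂ)`
as a real algebra, cf. `Beta.PlaquetteVertex` §4).
§1 The inverse path `invPath [b₁,…,b_n] = [−b_n,…,−b₁]`: `Σ(invPath l) = −Σl` (`sum_inv`); the CONCATENATION LAW
   `commSum (l₁ ++ l₂) = commSum l₁ + commSum l₂ + [Σl₁, Σl₂]` (`commSum_append`) and `commSum (invPath l) = −commSum l`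
   (`commSum_inv`); `holPath (invPath l) t · holPath l t = 1 = holPath l t · holPath (invPath l) t`
   (`holPath_inv_mul`, `holPath_mul_inv`; packaged as the unit `holUnit`); `holPath (l₁ ++ l₂) = holPath l₁ · holPath l₂`
   (`holPath_append`, the composition law behind (3.15)); the jets of the inverse holonomy at zero background
   `D₁ (invPath l) 0 = −S`, `D₂ (invPath l) 0 = S² − C` (`D₁_inv_zero`, `D₂_inv_zero`) with `S = Σl`, `C = commSum l`.
§2 The conjugation path `conjPath l A t = holPath l t · A · holPath (invPath l) t` (= conjugation by `holUnit`,
   `conjPath_eq_units_conj`): linear in `A`, MULTIPLICATIVE and UNITAL (`conjPath_mul`, `conjPath_one`), iterated along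
   concatenated contours (`conjPath_append`: `Ad_{l₁++l₂} = Ad_{l₁} ∘ Ad_{l₂}`), invisible to tracial functionals
   (`trace_conjPath`); differentiable at every `t` with Leibniz-form derivatives `conjD₁`, `conjD₂`
   (`hasDerivAt_conjPath`, `hasDerivAt_conjD₁`); and THE JETS AT ZERO BACKGROUND
     `(d/dt)|₀ Hol·A·Hol⁻¹ = [S, A]`                                  (`conjD₁_zero`),
     `(d²/dt²)|₀ Hol·A·Hol⁻¹ = [S,[S,A]] + [C, A]`,  `C = Σ_{i<j}[b_i,b_j]`   (`conjD₂_zero`, `conjD₂_zero_eq_comm`,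
   summary `conj_jet_zero`) — the single commutator with the PATH-ORDERING letter `C` is the only memory of the order
   of the bonds at second order (it vanishes for one-bond paths and abelian backgrounds, see the Examples); both jets
   are traceless (`trace_conj_jets_zero`) and bounded UNIFORMLY IN THE NUMBER OF BONDS given the size:
   `‖jet₁‖ ≤ 2·size l·‖A‖`, `‖jet₂‖ ≤ 6·(size l)²·‖A‖` (`norm_conjD₁_zero_le`, `norm_conjD₂_zero_le`).
§3 The shape (3.19): `avgPath w p lam t = Σ_x w_x · conjPath (p x) (lam x) t` for ANY weights `w`, ANY assignment
   `p : X → List 𝔸` of background letters to the fine points (the contour datum) and any fine field `lam`; its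
   derivative at every `t` (`hasDerivAt_avgPath`) and its first/second jets at zero background = the explicit STENCILS
   `avgJet₁ = Σ_x w_x·[S_x, λ_x]`, `avgJet₂ = Σ_x w_x·([S_x,[S_x,λ_x]] + [C_x,λ_x])` (`hasDerivAt_avgPath_zero`,
   `hasDerivAt_avgD₁_zero`), traceless (`trace_avgJets`).

WHAT IS NOT TYPED HERE (scope, Edison census).  (i) The contour geometry — WHICH letters `p x` are (B7 p.24 / p.19 /
p.29 for the contours `Γ_{y,x}` / `Γ_{c,x}` / the composite ones; the vector formula B7 (124) for `Q(V)`, which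
transports bond variables along partial contours AND carries the BCH dressing recalled above): that transcription is
node VH-STENCIL proper and only instantiates `p`/`w` here (plus `Beta.AveragingCorrectionJets` for the dressing).  (ii) Backgrounds
`U ≠ 1` (letters `e^{W_b + tB_b}`): not needed for the order-`g⁰` brick (T-def) at `U = 1` (an2, `BETA/AN2.md` §19),
and the place where BCH enters.  (iii) The loop side: the `O(B²)` coefficient of `log det` of the bordered family with
these `Q`-jets inserted is ALREADY typed in an2/pv09's `Beta.LogDetHessian` (`dQ`, `d2Q`, `master_formula`) and the
bordered-inverse jets in `Beta.BorderedJets` (`δQ`); this leaf feeds their `dQ/d2Q/δQ` slots BY NAME and restates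
nothing of them.  (iv) No sign, no `β̄_k`: a stencil is not a coefficient.

STATUS: [folklore] throughout (normed-algebra calculus over Mathlib's `NormedSpace.exp` and `HasDerivAt`); 0 `sorry`;
axioms = the standard three.  v1 (2026-08-19, b2b-balaban-beta-an1-g10, node BETA-an1-g10-ADJOINT-TRANSPORT-JETS);
v1.0.1 (same day): DOCSTRING-ONLY fixes owed to the XREAD of v1 (beta-lit3-g18: D1 quotation marks/elision of (3.19),
D2 scope sentence vs. the BCH dressing of (124), D3 contour locators; I1 B7 (56)–(57) cited; I2 dictionary remark on
`conjPath`) — no declaration changed.  v1.0.2 (same day): DOCSTRING-ONLY — the ABSOLUTE RULE header line (beta-ref A-R371); no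
declaration changed.  KERNEL DICTIONARY REMARK (I2, checked by the XREAD's pins, not restated as
theorems here): for a one-letter path, `conjPath 𝕜 [a] A t = BackgroundVertices.conjExp a A t`,
`conjD₁ 𝕜 [a] A 0 = BackgroundVertices.ad a A`, `conjD₂ 𝕜 [a] A 0 = ad a (ad a A)`.
-/

noncomputable section

open NormedSpace

namespace Literature.MathematicalPhysics.QuantumFieldTheory.Balaban1983to89.Beta.AdjointTransportJets

open Literature.MathematicalPhysics.QuantumFieldTheory.Balaban1983to89.Beta.TransportVertices
open Literature.MathematicalPhysics.QuantumFieldTheory.Balaban1983to89.Beta.BackgroundVertices (mem_eball_expSeries_radius)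

section InversePath

variable (𝕜 : Type*) [RCLike 𝕜] {𝔸 : Type*} [NormedRing 𝔸] [NormedAlgebra 𝕜 𝔸] [CompleteSpace 𝔸]

/-- The INVERSE PATH: the same bonds traversed backwards with reversed orientation,
`invPath [b₁, …, b_n] = [−b_n, …, −b₁]`. [folklore] -/
def invPath (l : List 𝔸) : List 𝔸 := (l.map Neg.neg).reverse

omit [NormedAlgebra 𝕜 𝔸] [CompleteSpace 𝔸] in
/-- `invPath [] = []`. [folklore] -/
@[simp] theorem invPath_nil : invPath ([] : List 𝔸) = [] := rfl

omit [NormedAlgebra 𝕜 𝔸] [CompleteSpace 𝔸] in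
/-- `invPath (b :: l) = invPath l ++ [−b]`. [folklore] -/
@[simp] theorem invPath_cons (b : 𝔸) (l : List 𝔸) : invPath (b :: l) = invPath l ++ [-b] := by
  simp [invPath]

omit [NormedAlgebra 𝕜 𝔸] [CompleteSpace 𝔸] in
/-- `invPath` is an involution. [folklore] -/
theorem invPath_invPath (l : List 𝔸) : invPath (invPath l) = l := by
  simp [invPath, List.map_reverse]

omit [NormedAlgebra 𝕜 𝔸] [CompleteSpace 𝔸] in
/-- The letters of the inverse path sum to minus the letters of the path: `Σ (invPath l) = −Σ l`. [folklore] -/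
theorem sum_inv (l : List 𝔸) : (invPath l).sum = -l.sum := by
  induction l with
  | nil => simp
  | cons b l ih => simp [ih, add_comm]

omit [NormedAlgebra 𝕜 𝔸] [CompleteSpace 𝔸] in
/-- The inverse of a concatenated path is the concatenation of the inverses in the opposite order. [folklore] -/
theorem invPath_append (l₁ l₂ : List 𝔸) : invPath (l₁ ++ l₂) = invPath l₂ ++ invPath l₁ := by
  simp [invPath]

omit [NormedAlgebra 𝕜 𝔸] [CompleteSpace 𝔸] in
/-- CONCATENATION LAW of the ordered commutator sum: `commSum (l₁ ++ l₂) = commSum l₁ + commSum l₂ + [Σl₁, Σl₂]`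
(every letter of `l₁` precedes every letter of `l₂`). [folklore] -/
theorem commSum_append (l₁ l₂ : List 𝔸) :
    commSum (l₁ ++ l₂) = commSum l₁ + commSum l₂ + (l₁.sum * l₂.sum - l₂.sum * l₁.sum) := by
  induction l₁ with
  | nil => simp
  | cons a l₁ ih =>
    simp only [List.cons_append, commSum_cons, ih, List.sum_append, List.sum_cons]
    noncomm_ring

omit [NormedAlgebra 𝕜 𝔸] [CompleteSpace 𝔸] in
/-- Appending one letter at the END of a path adds its commutators with every earlier letter:
`commSum (l ++ [c]) = commSum l + (Σl · c − c · Σl)`. [folklore] -/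
theorem commSum_append_singleton (l : List 𝔸) (c : 𝔸) :
    commSum (l ++ [c]) = commSum l + (l.sum * c - c * l.sum) := by
  induction l with
  | nil => simp
  | cons b l ih =>
    simp only [List.cons_append, commSum_cons, ih, List.sum_append, List.sum_cons, List.sum_nil, add_zero]
    noncomm_ring

omit [NormedAlgebra 𝕜 𝔸] [CompleteSpace 𝔸] in
/-- The ordered commutator sum of the inverse path is MINUS that of the path: `commSum (invPath l) = −commSum l`
(reversal flips every ordered pair, the two sign changes of the letters cancel). [folklore] -/
theorem commSum_inv (l : List 𝔸) : commSum (invPath l) = -commSum l := by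
  induction l with
  | nil => simp
  | cons b l ih =>
    rw [invPath_cons, commSum_append_singleton, ih, sum_inv, commSum_cons]
    noncomm_ring

omit [CompleteSpace 𝔸] in
/-- `holPath (invPath (b :: l)) t = holPath (invPath l) t · exp (−t b)`. [folklore] -/
theorem holPath_inv_cons (b : 𝔸) (l : List 𝔸) (t : 𝕜) :
    holPath 𝕜 (invPath (b :: l)) t = holPath 𝕜 (invPath l) t * exp (-(t • b)) := by
  simp [holPath, holonomy, invPath, List.map_reverse, smul_neg]

/-- THE INVERSE PATH CARRIES THE INVERSE HOLONOMY (left): `holPath (invPath l) t · holPath l t = 1`. [folklore] -/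
theorem holPath_inv_mul (l : List 𝔸) (t : 𝕜) : holPath 𝕜 (invPath l) t * holPath 𝕜 l t = 1 := by
  induction l with
  | nil => simp
  | cons b l ih =>
    have hc : exp (-(t • b)) * exp (t • b) = (1 : 𝔸) := by
      rw [← exp_add_of_commute_of_mem_ball (Commute.refl (t • b)).neg_left
        (mem_eball_expSeries_radius 𝕜 (-(t • b))) (mem_eball_expSeries_radius 𝕜 (t • b)),
        neg_add_cancel, exp_zero]
    rw [holPath_inv_cons, holPath_cons]
    calc holPath 𝕜 (invPath l) t * exp (-(t • b)) * (exp (t • b) * holPath 𝕜 l t)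
        = holPath 𝕜 (invPath l) t * (exp (-(t • b)) * exp (t • b)) * holPath 𝕜 l t := by noncomm_ring
      _ = 1 := by rw [hc, mul_one, ih]

/-- THE INVERSE PATH CARRIES THE INVERSE HOLONOMY (right): `holPath l t · holPath (invPath l) t = 1`. [folklore] -/
theorem holPath_mul_inv (l : List 𝔸) (t : 𝕜) : holPath 𝕜 l t * holPath 𝕜 (invPath l) t = 1 := by
  induction l with
  | nil => simp
  | cons b l ih =>
    have hc : exp (t • b) * exp (-(t • b)) = (1 : 𝔸) := by
      rw [← exp_add_of_commute_of_mem_ball (Commute.refl (t • b)).neg_right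
        (mem_eball_expSeries_radius 𝕜 (t • b)) (mem_eball_expSeries_radius 𝕜 (-(t • b))),
        add_neg_cancel, exp_zero]
    rw [holPath_inv_cons, holPath_cons]
    calc exp (t • b) * holPath 𝕜 l t * (holPath 𝕜 (invPath l) t * exp (-(t • b)))
        = exp (t • b) * (holPath 𝕜 l t * holPath 𝕜 (invPath l) t) * exp (-(t • b)) := by noncomm_ring
      _ = 1 := by rw [ih, mul_one, hc]

omit [CompleteSpace 𝔸] in
/-- CONCATENATED CONTOURS MULTIPLY HOLONOMIES: `holPath (l₁ ++ l₂) t = holPath l₁ t · holPath l₂ t` (the composition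
law behind [Balaban1985BackgroundPropagators] (3.15) `Q_j(U) = Q(Ū^{j−1})·…·Q(Ū)Q(U)`). [folklore] -/
theorem holPath_append (l₁ l₂ : List 𝔸) (t : 𝕜) : holPath 𝕜 (l₁ ++ l₂) t = holPath 𝕜 l₁ t * holPath 𝕜 l₂ t := by
  simp [holPath, holonomy, List.map_append, List.prod_append]

/-- The holonomy along the path as a UNIT of `𝔸`, with inverse the holonomy along the inverse path. [folklore] -/
def holUnit (l : List 𝔸) (t : 𝕜) : 𝔸ˣ :=
  ⟨holPath 𝕜 l t, holPath 𝕜 (invPath l) t, holPath_mul_inv 𝕜 l t, holPath_inv_mul 𝕜 l t⟩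

/-- `holUnit l t` has value `holPath l t`. [folklore] -/
@[simp] theorem val_holUnit (l : List 𝔸) (t : 𝕜) : (holUnit 𝕜 l t : 𝔸) = holPath 𝕜 l t := rfl

/-- … and inverse `holPath (invPath l) t`. [folklore] -/
@[simp] theorem val_inv_holUnit (l : List 𝔸) (t : 𝕜) : (↑(holUnit 𝕜 l t)⁻¹ : 𝔸) = holPath 𝕜 (invPath l) t := rfl

omit [CompleteSpace 𝔸] in
/-- First variation of the inverse holonomy at zero background: `D₁ (invPath l) 0 = −Σ l`. [folklore] -/
theorem D₁_inv_zero (l : List 𝔸) : D₁ 𝕜 (invPath l) 0 = -l.sum := by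
  rw [D₁_zero, sum_inv]

omit [CompleteSpace 𝔸] in
/-- Second variation of the inverse holonomy at zero background: `D₂ (invPath l) 0 = (Σl)² − commSum l` — the
path-ordering correction changes sign. [folklore] -/
theorem D₂_inv_zero (l : List 𝔸) : D₂ 𝕜 (invPath l) 0 = l.sum * l.sum - commSum l := by
  rw [D₂_zero, sum_inv, commSum_inv]
  noncomm_ring

end InversePath

section Conjugation

variable (𝕜 : Type*) [RCLike 𝕜] {𝔸 : Type*} [NormedRing 𝔸] [NormedAlgebra 𝕜 𝔸] [CompleteSpace 𝔸]

/-- THE CONJUGATION (ADJOINT-TRANSPORT) PATH: the fine field `A` transported by the adjoint action of the holonomy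
along the path with the background switched on at strength `t`,
`conjPath l A t = Hol_l(t) · A · Hol_l(t)⁻¹ = (Π_j e^{t b_j}) · A · (Π_j e^{t b_j})⁻¹` — Bałaban's adjoint
representation, [Balaban1985Averaging] p.27 (56) «R(X)Y = XYX⁻¹», (57) «R(X)R(Y) = R(XY)» (= `conjPath_append`);
for one letter it is `BackgroundVertices.conjExp`. [folklore] -/
def conjPath (l : List 𝔸) (A : 𝔸) (t : 𝕜) : 𝔸 := holPath 𝕜 l t * A * holPath 𝕜 (invPath l) t

omit [CompleteSpace 𝔸] in
/-- At zero background the transport is the identity: `conjPath l A 0 = A`. [folklore] -/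
@[simp] theorem conjPath_zero (l : List 𝔸) (A : 𝔸) : conjPath 𝕜 l A 0 = A := by
  simp [conjPath]

omit [CompleteSpace 𝔸] in
/-- The empty path transports trivially. [folklore] -/
@[simp] theorem conjPath_nil (A : 𝔸) : conjPath 𝕜 ([] : List 𝔸) A = fun _ => A := by
  funext t; simp [conjPath, invPath]

omit [CompleteSpace 𝔸] in
/-- Linearity in the transported field. [folklore] -/
theorem conjPath_add (l : List 𝔸) (A B : 𝔸) (t : 𝕜) :
    conjPath 𝕜 l (A + B) t = conjPath 𝕜 l A t + conjPath 𝕜 l B t := by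
  simp [conjPath, mul_add, add_mul]

omit [CompleteSpace 𝔸] in
/-- Homogeneity in the transported field. [folklore] -/
theorem conjPath_smul (l : List 𝔸) (c : 𝕜) (A : 𝔸) (t : 𝕜) :
    conjPath 𝕜 l (c • A) t = c • conjPath 𝕜 l A t := by
  simp [conjPath]

/-- The adjoint transport is MULTIPLICATIVE: `Ad(AB) = Ad(A)·Ad(B)`. [folklore] -/
theorem conjPath_mul (l : List 𝔸) (A B : 𝔸) (t : 𝕜) :
    conjPath 𝕜 l (A * B) t = conjPath 𝕜 l A t * conjPath 𝕜 l B t := by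
  unfold conjPath
  calc holPath 𝕜 l t * (A * B) * holPath 𝕜 (invPath l) t
      = holPath 𝕜 l t * A * (holPath 𝕜 (invPath l) t * holPath 𝕜 l t) * B * holPath 𝕜 (invPath l) t := by
        rw [holPath_inv_mul]; noncomm_ring
    _ = holPath 𝕜 l t * A * holPath 𝕜 (invPath l) t * (holPath 𝕜 l t * B * holPath 𝕜 (invPath l) t) := by
        noncomm_ring

/-- … and UNITAL: `Ad(1) = 1`. [folklore] -/
theorem conjPath_one (l : List 𝔸) (t : 𝕜) : conjPath 𝕜 l 1 t = 1 := by
  simp [conjPath, holPath_mul_inv]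

/-- The adjoint transport IS conjugation by the unit `holUnit l t`. [folklore] -/
theorem conjPath_eq_units_conj (l : List 𝔸) (A : 𝔸) (t : 𝕜) :
    conjPath 𝕜 l A t = (holUnit 𝕜 l t : 𝔸) * A * ↑(holUnit 𝕜 l t)⁻¹ := rfl

omit [CompleteSpace 𝔸] in
/-- TRANSPORT ALONG A CONCATENATED CONTOUR IS ITERATED TRANSPORT: `Ad_{l₁ ++ l₂} = Ad_{l₁} ∘ Ad_{l₂}`. [folklore] -/
theorem conjPath_append (l₁ l₂ : List 𝔸) (A : 𝔸) (t : 𝕜) :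
    conjPath 𝕜 (l₁ ++ l₂) A t = conjPath 𝕜 l₁ (conjPath 𝕜 l₂ A t) t := by
  simp only [conjPath, holPath_append, invPath_append]
  noncomm_ring

/-- TRACIAL FUNCTIONALS ARE TRANSPORT INVARIANT: `τ (Hol·A·Hol⁻¹) = τ A` for every `τ` with `τ(ab) = τ(ba)`.
[folklore] -/
theorem trace_conjPath {V : Type*} [AddCommGroup V] [Module 𝕜 V] (τ : 𝔸 →ₗ[𝕜] V)
    (hτ : ∀ a b : 𝔸, τ (a * b) = τ (b * a)) (l : List 𝔸) (A : 𝔸) (t : 𝕜) :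
    τ (conjPath 𝕜 l A t) = τ A := by
  unfold conjPath
  rw [hτ, ← mul_assoc, holPath_inv_mul, one_mul]

/-- First derivative of the conjugation path (Leibniz form over `TransportVertices.D₁`). [folklore] -/
def conjD₁ (l : List 𝔸) (A : 𝔸) (t : 𝕜) : 𝔸 :=
  D₁ 𝕜 l t * A * holPath 𝕜 (invPath l) t + holPath 𝕜 l t * A * D₁ 𝕜 (invPath l) t

/-- Second derivative of the conjugation path (Leibniz form over `TransportVertices.D₁/D₂`). [folklore] -/
def conjD₂ (l : List 𝔸) (A : 𝔸) (t : 𝕜) : 𝔸 :=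
  D₂ 𝕜 l t * A * holPath 𝕜 (invPath l) t + 2 • (D₁ 𝕜 l t * A * D₁ 𝕜 (invPath l) t) +
    holPath 𝕜 l t * A * D₂ 𝕜 (invPath l) t

/-- `t ↦ Hol(t)·A·Hol(t)⁻¹` is differentiable at every `t`, with derivative `conjD₁ l A t`. [folklore] -/
theorem hasDerivAt_conjPath (l : List 𝔸) (A : 𝔸) (t : 𝕜) :
    HasDerivAt (conjPath 𝕜 l A) (conjD₁ 𝕜 l A t) t := by
  have h := ((hasDerivAt_holPath 𝕜 l t).mul_const A).mul (hasDerivAt_holPath 𝕜 (invPath l) t)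
  exact h.congr_deriv (by simp [conjD₁])

/-- `conjD₁ l A` is differentiable at every `t`, with derivative `conjD₂ l A t`. [folklore] -/
theorem hasDerivAt_conjD₁ (l : List 𝔸) (A : 𝔸) (t : 𝕜) :
    HasDerivAt (conjD₁ 𝕜 l A) (conjD₂ 𝕜 l A t) t := by
  have h1 := ((hasDerivAt_D₁ 𝕜 l t).mul_const A).mul (hasDerivAt_holPath 𝕜 (invPath l) t)
  have h2 := ((hasDerivAt_holPath 𝕜 l t).mul_const A).mul (hasDerivAt_D₁ 𝕜 (invPath l) t)
  have h : HasDerivAt (conjD₁ 𝕜 l A) _ t := h1.add h2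
  refine h.congr_deriv ?_
  simp only [conjD₂, two_smul]
  noncomm_ring

omit [CompleteSpace 𝔸] in
/-- THE FIRST JET AT ZERO BACKGROUND IS THE COMMUTATOR WITH THE ACCUMULATED BACKGROUND:
`(d/dt)|₀ Hol(t)·A·Hol(t)⁻¹ = (Σ_j b_j)·A − A·(Σ_j b_j) = [S, A]`. [folklore] -/
theorem conjD₁_zero (l : List 𝔸) (A : 𝔸) : conjD₁ 𝕜 l A 0 = l.sum * A - A * l.sum := by
  simp [conjD₁, sum_inv, sub_eq_add_neg]

omit [CompleteSpace 𝔸] in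
/-- THE SECOND JET AT ZERO BACKGROUND, Leibniz form: `(d²/dt²)|₀ = (S² + C)·A − 2·S·A·S + A·(S² − C)` with `S = Σ_j b_j`
and `C = commSum l = Σ_{i<j}[b_i, b_j]` the PATH-ORDERING correction. [folklore] -/
theorem conjD₂_zero (l : List 𝔸) (A : 𝔸) :
    conjD₂ 𝕜 l A 0 = (l.sum * l.sum + commSum l) * A - 2 • (l.sum * A * l.sum)
      + A * (l.sum * l.sum - commSum l) := by
  simp only [conjD₂, D₂_zero, D₁_zero, holPath_zero, sum_inv, commSum_inv, mul_one, one_mul, two_smul]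
  noncomm_ring

omit [CompleteSpace 𝔸] in
/-- THE SECOND JET AT ZERO BACKGROUND, commutator form: `(d²/dt²)|₀ Hol·A·Hol⁻¹ = [S,[S,A]] + [C, A]` — the double
commutator with the accumulated background PLUS the single commutator with the ordered commutator sum
`C = Σ_{i<j}[b_i,b_j]` (absent for a one-bond path or an abelian background). [folklore] -/
theorem conjD₂_zero_eq_comm (l : List 𝔸) (A : 𝔸) :
    conjD₂ 𝕜 l A 0 = (l.sum * (l.sum * A - A * l.sum) - (l.sum * A - A * l.sum) * l.sum)
      + (commSum l * A - A * commSum l) := by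
  rw [conjD₂_zero, two_smul]
  noncomm_ring

omit [CompleteSpace 𝔸] in
/-- SIZE OF THE FIRST JET, uniform in the number of bonds: `‖[S, A]‖ ≤ 2 · size l · ‖A‖`. [folklore] -/
theorem norm_conjD₁_zero_le (l : List 𝔸) (A : 𝔸) : ‖conjD₁ 𝕜 l A 0‖ ≤ 2 * size l * ‖A‖ := by
  rw [conjD₁_zero]
  have hS := norm_sum_le_size l
  have h0 : 0 ≤ ‖A‖ := norm_nonneg A
  calc ‖l.sum * A - A * l.sum‖ ≤ ‖l.sum * A‖ + ‖A * l.sum‖ := norm_sub_le _ _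
    _ ≤ ‖l.sum‖ * ‖A‖ + ‖A‖ * ‖l.sum‖ := add_le_add (norm_mul_le _ _) (norm_mul_le _ _)
    _ ≤ size l * ‖A‖ + ‖A‖ * size l := by gcongr
    _ = 2 * size l * ‖A‖ := by ring

omit [CompleteSpace 𝔸] in
/-- SIZE OF THE SECOND JET, uniform in the number of bonds: `‖[S,[S,A]] + [C,A]‖ ≤ 6 · (size l)² · ‖A‖`
(`‖S‖ ≤ size l`, `‖C‖ ≤ (size l)²` from `TransportVertices`). [folklore] -/
theorem norm_conjD₂_zero_le (l : List 𝔸) (A : 𝔸) : ‖conjD₂ 𝕜 l A 0‖ ≤ 6 * size l ^ 2 * ‖A‖ := by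
  rw [conjD₂_zero_eq_comm]
  have hS := norm_sum_le_size l
  have hC := norm_commSum_le l
  have h0 : 0 ≤ ‖A‖ := norm_nonneg A
  have hs : 0 ≤ size l := size_nonneg l
  have hX : ‖l.sum * A - A * l.sum‖ ≤ 2 * size l * ‖A‖ := by
    simpa [conjD₁_zero] using norm_conjD₁_zero_le 𝕜 l A
  have h1 : ‖l.sum * (l.sum * A - A * l.sum) - (l.sum * A - A * l.sum) * l.sum‖ ≤ 4 * size l ^ 2 * ‖A‖ := by
    calc ‖l.sum * (l.sum * A - A * l.sum) - (l.sum * A - A * l.sum) * l.sum‖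
        ≤ ‖l.sum * (l.sum * A - A * l.sum)‖ + ‖(l.sum * A - A * l.sum) * l.sum‖ := norm_sub_le _ _
      _ ≤ ‖l.sum‖ * ‖l.sum * A - A * l.sum‖ + ‖l.sum * A - A * l.sum‖ * ‖l.sum‖ :=
          add_le_add (norm_mul_le _ _) (norm_mul_le _ _)
      _ ≤ size l * (2 * size l * ‖A‖) + (2 * size l * ‖A‖) * size l := by gcongr
      _ = 4 * size l ^ 2 * ‖A‖ := by ring
  have h2 : ‖commSum l * A - A * commSum l‖ ≤ 2 * size l ^ 2 * ‖A‖ := by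
    calc ‖commSum l * A - A * commSum l‖ ≤ ‖commSum l * A‖ + ‖A * commSum l‖ := norm_sub_le _ _
      _ ≤ ‖commSum l‖ * ‖A‖ + ‖A‖ * ‖commSum l‖ := add_le_add (norm_mul_le _ _) (norm_mul_le _ _)
      _ ≤ size l ^ 2 * ‖A‖ + ‖A‖ * size l ^ 2 := by gcongr
      _ = 2 * size l ^ 2 * ‖A‖ := by ring
  calc _ ≤ ‖l.sum * (l.sum * A - A * l.sum) - (l.sum * A - A * l.sum) * l.sum‖ + ‖commSum l * A - A * commSum l‖ :=
        norm_add_le _ _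
    _ ≤ 4 * size l ^ 2 * ‖A‖ + 2 * size l ^ 2 * ‖A‖ := add_le_add h1 h2
    _ = 6 * size l ^ 2 * ‖A‖ := by ring

/-- Summary at zero background: value `A`, first jet `[S, A]`, second jet `[S,[S,A]] + [C,A]`. [folklore] -/
theorem conj_jet_zero (l : List 𝔸) (A : 𝔸) :
    conjPath 𝕜 l A 0 = A ∧ HasDerivAt (conjPath 𝕜 l A) (l.sum * A - A * l.sum) 0 ∧
      HasDerivAt (conjD₁ 𝕜 l A) ((l.sum * (l.sum * A - A * l.sum) - (l.sum * A - A * l.sum) * l.sum)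
        + (commSum l * A - A * commSum l)) 0 := by
  refine ⟨conjPath_zero 𝕜 l A, ?_, ?_⟩
  · simpa [conjD₁_zero] using hasDerivAt_conjPath 𝕜 l A 0
  · simpa [conjD₂_zero_eq_comm] using hasDerivAt_conjD₁ 𝕜 l A 0

omit [CompleteSpace 𝔸] in
/-- BOTH JETS ARE TRACELESS for tracial `τ` (they are sums of commutators) — consistent with `trace_conjPath`.
[folklore] -/
theorem trace_conj_jets_zero {V : Type*} [AddCommGroup V] [Module 𝕜 V] (τ : 𝔸 →ₗ[𝕜] V)
    (hτ : ∀ a b : 𝔸, τ (a * b) = τ (b * a)) (l : List 𝔸) (A : 𝔸) :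
    τ (conjD₁ 𝕜 l A 0) = 0 ∧ τ (conjD₂ 𝕜 l A 0) = 0 := by
  constructor
  · rw [conjD₁_zero, map_sub, hτ, sub_self]
  · rw [conjD₂_zero_eq_comm, map_add]
    have h1 : τ (l.sum * (l.sum * A - A * l.sum) - (l.sum * A - A * l.sum) * l.sum) = 0 := by
      rw [map_sub, hτ, sub_self]
    have h2 : τ (commSum l * A - A * commSum l) = 0 := by
      rw [map_sub, hτ, sub_self]
    rw [h1, h2, add_zero]

end Conjugation

section BlockAverage

variable (𝕜 : Type*) [RCLike 𝕜] {𝔸 : Type*} [NormedRing 𝔸] [NormedAlgebra 𝕜 𝔸] [CompleteSpace 𝔸]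
variable {X : Type*} [Fintype X]

/-- THE SHAPE OF A LINEARISED COVARIANT BLOCK AVERAGING at background strength `t` ([Balaban1985BackgroundPropagators]
(3.19): `(Q′(V)λ)(y) = Σ_{x∈B(y)} L^{−d} R(V(Γ_{y,x})) λ(x)` with `V = e^{tB}`): a weighted sum over the fine points `x`
of the field `lam x` adjoint-transported along the path `p x` (the list of background letters met along `Γ_{y,x}`).
The contour geometry (WHICH letters: [B7] p.24 `Γ_{y,x}`, p.19 `Γ_{c,x}`, p.29 composite; (124)/(125)) is the datum `p`;
nothing about it is assumed. [folklore] -/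
def avgPath (w : X → 𝕜) (p : X → List 𝔸) (lam : X → 𝔸) (t : 𝕜) : 𝔸 :=
  ∑ x, w x • conjPath 𝕜 (p x) (lam x) t

/-- The first-jet STENCIL of the averaging: `Σ_x w_x · [S_x, λ_x]`, `S_x = Σ (p x)`. [folklore] -/
def avgJet₁ (w : X → 𝕜) (p : X → List 𝔸) (lam : X → 𝔸) : 𝔸 :=
  ∑ x, w x • ((p x).sum * lam x - lam x * (p x).sum)

/-- The second-jet STENCIL of the averaging: `Σ_x w_x · ([S_x,[S_x,λ_x]] + [C_x, λ_x])`. [folklore] -/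
def avgJet₂ (w : X → 𝕜) (p : X → List 𝔸) (lam : X → 𝔸) : 𝔸 :=
  ∑ x, w x • (((p x).sum * ((p x).sum * lam x - lam x * (p x).sum)
      - ((p x).sum * lam x - lam x * (p x).sum) * (p x).sum)
    + (commSum (p x) * lam x - lam x * commSum (p x)))

omit [CompleteSpace 𝔸] in
/-- At zero background the averaging is the plain weighted block sum. [folklore] -/
theorem avgPath_zero (w : X → 𝕜) (p : X → List 𝔸) (lam : X → 𝔸) :
    avgPath 𝕜 w p lam 0 = ∑ x, w x • lam x := by
  simp [avgPath]

/-- The averaging path is differentiable at every `t` (termwise `hasDerivAt_conjPath`). [folklore] -/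
theorem hasDerivAt_avgPath (w : X → 𝕜) (p : X → List 𝔸) (lam : X → 𝔸) (t : 𝕜) :
    HasDerivAt (avgPath 𝕜 w p lam) (∑ x, w x • conjD₁ 𝕜 (p x) (lam x) t) t := by
  have h : HasDerivAt (fun s => ∑ x, w x • conjPath 𝕜 (p x) (lam x) s)
      (∑ x, w x • conjD₁ 𝕜 (p x) (lam x) t) t :=
    HasDerivAt.fun_sum fun x _ => (hasDerivAt_conjPath 𝕜 (p x) (lam x) t).const_smul (w x)
  exact h

/-- FIRST JET OF THE AVERAGING AT ZERO BACKGROUND = the first-jet stencil. [folklore] -/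
theorem hasDerivAt_avgPath_zero (w : X → 𝕜) (p : X → List 𝔸) (lam : X → 𝔸) :
    HasDerivAt (avgPath 𝕜 w p lam) (avgJet₁ 𝕜 w p lam) 0 := by
  have h := hasDerivAt_avgPath 𝕜 w p lam 0
  simpa [avgJet₁, conjD₁_zero] using h

/-- SECOND JET OF THE AVERAGING AT ZERO BACKGROUND = the second-jet stencil (as the derivative at `0` of the
first-derivative function `t ↦ Σ_x w_x · conjD₁ (p x) (lam x) t`). [folklore] -/
theorem hasDerivAt_avgD₁_zero (w : X → 𝕜) (p : X → List 𝔸) (lam : X → 𝔸) :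
    HasDerivAt (fun t => ∑ x, w x • conjD₁ 𝕜 (p x) (lam x) t) (avgJet₂ 𝕜 w p lam) 0 := by
  have h : HasDerivAt (fun s => ∑ x, w x • conjD₁ 𝕜 (p x) (lam x) s)
      (∑ x, w x • conjD₂ 𝕜 (p x) (lam x) 0) 0 :=
    HasDerivAt.fun_sum fun x _ => (hasDerivAt_conjD₁ 𝕜 (p x) (lam x) 0).const_smul (w x)
  simpa [avgJet₂, conjD₂_zero_eq_comm] using h

omit [CompleteSpace 𝔸] in
/-- Both stencils are TRACELESS termwise for tracial `τ`. [folklore] -/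
theorem trace_avgJets {V : Type*} [AddCommGroup V] [Module 𝕜 V] (τ : 𝔸 →ₗ[𝕜] V)
    (hτ : ∀ a b : 𝔸, τ (a * b) = τ (b * a)) (w : X → 𝕜) (p : X → List 𝔸) (lam : X → 𝔸) :
    τ (avgJet₁ 𝕜 w p lam) = 0 ∧ τ (avgJet₂ 𝕜 w p lam) = 0 := by
  constructor
  · simp only [avgJet₁, map_sum, map_smul]
    refine Finset.sum_eq_zero fun x _ => ?_
    rw [← conjD₁_zero 𝕜, (trace_conj_jets_zero 𝕜 τ hτ (p x) (lam x)).1, smul_zero]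
  · simp only [avgJet₂, map_sum, map_smul]
    refine Finset.sum_eq_zero fun x _ => ?_
    rw [← conjD₂_zero_eq_comm 𝕜, (trace_conj_jets_zero 𝕜 τ hτ (p x) (lam x)).2, smul_zero]

end BlockAverage

section Examples

variable (𝕜 : Type*) [RCLike 𝕜] {𝔸 : Type*} [NormedRing 𝔸] [NormedAlgebra 𝕜 𝔸] [CompleteSpace 𝔸]

omit [NormedAlgebra 𝕜 𝔸] [CompleteSpace 𝔸] in
/-- A two-bond path: `invPath [a, b] = [−b, −a]`. -/
example (a b : 𝔸) : invPath [a, b] = [-b, -a] := by simp [invPath]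

omit [CompleteSpace 𝔸] in
/-- A ONE-bond path has no path-ordering correction: the second jet is the pure double commutator `[b,[b,A]]`. -/
example (b A : 𝔸) : conjD₂ 𝕜 [b] A 0 = b * (b * A - A * b) - (b * A - A * b) * b := by
  rw [conjD₂_zero_eq_comm]
  simp

omit [CompleteSpace 𝔸] in
/-- A two-bond path: the correction letter is the single commutator `[a, b]`. -/
example (a b A : 𝔸) :
    conjD₂ 𝕜 [a, b] A 0 = ((a + b) * ((a + b) * A - A * (a + b)) - ((a + b) * A - A * (a + b)) * (a + b))
      + ((a * b - b * a) * A - A * (a * b - b * a)) := by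
  rw [conjD₂_zero_eq_comm]
  simp

end Examples

end Literature.MathematicalPhysics.QuantumFieldTheory.Balaban1983to89.Beta.AdjointTransportJets
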